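import Mathlib
import Summits.Ventures.PercRepro2.RootCutEvents

/-!
# Two-root cuts: clusters across the root pair on `Q`
(blind cell PercRepro2, night-1 g32; proofs/NIGHT1-G32.md §6, the root-shield identity)

On `Q` (the roots joined inside neither side) a vertex `u` of the `S`-side is joined to a vertex `v`
of the `R`-side iff, for one root `a`, `u ↔ a` inside `S` and `a ↔ v` inside `R`
(`conn_across_iff`); hence the cluster of `x ∈ VS` is its `S`-cluster together with the `R`-cluster
of the root it reaches inside `S`, if any (`cluster_eq_union_root`, `cluster_eq_of_not_conn_roots`) —
the fibres of `x` are indexed by `(W_S, W_R)` as in the paper proof.  Standard axioms.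
-/

namespace Summit.Ventures.PercRepro2.RootCut

open CutV

variable {V : Type*} {E : Type*} {ends : E → Sym2 V} {a₁ a₂ : V} {VR VS : Set V} {ER ES : Set E}
  [DecidablePred (· ∈ ER)] [DecidablePred (· ∈ ES)]

omit [DecidablePred (· ∈ ER)] in
/-- An `S`-side cluster stays on the `S`-side. -/
theorem cluster_restrict_subset_S (h : IsRootCut ends a₁ a₂ VR VS ER ES) {ω : Config E} {u : V}
    (hu : u ∈ VS ∪ {a₁, a₂}) : cluster ends (restrict ES ω) u ⊆ VS ∪ {a₁, a₂} := by
  intro v hv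
  refine mem_of_conn_of_closed (S := VS ∪ {a₁, a₂}) ?_ hu hv
  intro a _ b hab
  rw [openGraph_adj] at hab
  obtain ⟨_, e, he, hends⟩ := hab
  have heS : e ∈ ES := by
    by_contra hcon
    rw [restrict_apply_of_notMem hcon] at he
    exact Bool.false_ne_true he
  exact (h.symm.ends_mem_of_mem_ER heS hends).2

omit [DecidablePred (· ∈ ES)] in
/-- An `R`-side cluster stays on the `R`-side. -/
theorem cluster_restrict_subset_R (h : IsRootCut ends a₁ a₂ VR VS ER ES) {ω : Config E} {u : V}
    (hu : u ∈ VR ∪ {a₁, a₂}) : cluster ends (restrict ER ω) u ⊆ VR ∪ {a₁, a₂} :=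
  cluster_restrict_subset_S h.symm hu

omit [DecidablePred (· ∈ ER)] [DecidablePred (· ∈ ES)] in
/-- Vertices off `VR ∪ VS ∪ {a₁, a₂}` are isolated: a connection starting in it stays there. -/
theorem mem_union_of_conn (h : IsRootCut ends a₁ a₂ VR VS ER ES) {ω : Config E} {u v : V}
    (hu : u ∈ VR ∪ VS ∪ {a₁, a₂}) (huv : Conn ends ω u v) : v ∈ VR ∪ VS ∪ {a₁, a₂} := by
  refine mem_of_conn_of_closed (S := VR ∪ VS ∪ {a₁, a₂}) ?_ hu huv
  intro a _ b hab
  rw [openGraph_adj] at hab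
  obtain ⟨_, e, _, hends⟩ := hab
  rcases h.cover e with hR | hS
  · rcases (h.ends_mem_of_mem_ER hR hends).2 with hb | hb
    · exact Or.inl (Or.inl hb)
    · exact Or.inr hb
  · rcases (h.symm.ends_mem_of_mem_ER hS hends).2 with hb | hb
    · exact Or.inl (Or.inr hb)
    · exact Or.inr hb

/-- **Path lemma across the root pair, on `Q`**: for `u ∈ VS`, `v ∈ VR`, `u ↔ v` iff for one root
`a`, `u ↔ a` inside `S` and `a ↔ v` inside `R`. -/
theorem conn_across_iff (h : IsRootCut ends a₁ a₂ VR VS ER ES) {ω : Config E}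
    (hR : ¬ Conn ends (restrict ER ω) a₁ a₂) (hS : ¬ Conn ends (restrict ES ω) a₁ a₂) {u v : V}
    (hu : u ∈ VS) (hv : v ∈ VR) :
    Conn ends ω u v ↔
      (Conn ends (restrict ES ω) u a₁ ∧ Conn ends (restrict ER ω) a₁ v) ∨
        (Conn ends (restrict ES ω) u a₂ ∧ Conn ends (restrict ER ω) a₂ v) := by
  have huS : u ∈ VS ∪ {a₁, a₂} := Or.inl hu
  have hvR : v ∈ VR ∪ {a₁, a₂} := Or.inl hv
  have hvS : v ∉ VS ∪ {a₁, a₂} := by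
    intro hc
    rcases h.eq_root_of_mem_both hvR hc with rfl | rfl
    · exact h.a₁_notR hv
    · exact h.a₂_notR hv
  have huR : u ∉ VR ∪ {a₁, a₂} := by
    intro hc
    rcases h.eq_root_of_mem_both hc huS with rfl | rfl
    · exact h.a₁_notS hu
    · exact h.a₂_notS hu
  constructor
  · intro huv
    -- collapse onto the `S`-side: `u ↔_S (the root `v` is `R`-joined to)`
    have keyS := conn_rootCollapse h hR huv
    rw [rootCollapse_of_mem huS] at keyS
    -- collapse onto the `R`-side: `(the root `u` is `S`-joined to) ↔_R v`
    have keyR := conn_rootCollapse h.symm hS huv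
    rw [rootCollapse_of_mem (VS := VR) hvR] at keyR
    by_cases hv2 : Conn ends (restrict ER ω) v a₂
    · rw [rootCollapse_of_conn₂ hvS hv2] at keyS
      exact Or.inr ⟨keyS, conn_symm hv2⟩
    · rw [rootCollapse_of_not_conn₂ hvS hv2] at keyS
      by_cases hu2 : Conn ends (restrict ES ω) u a₂
      · exact absurd (conn_trans (conn_symm keyS) hu2) hS
      · rw [rootCollapse_of_not_conn₂ (VS := VR) huR hu2] at keyR
        exact Or.inl ⟨keyS, keyR⟩
  · rintro (⟨h1, h2⟩ | ⟨h1, h2⟩)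
    · exact conn_trans (conn_mono (restrict_le ES ω) h1) (conn_mono (restrict_le ER ω) h2)
    · exact conn_trans (conn_mono (restrict_le ES ω) h1) (conn_mono (restrict_le ER ω) h2)

/-- The cluster of `x ∈ VS` when `x ↔ a` inside `S` for the root `a` (on `Q`): the `S`-cluster of
`x` together with the `R`-cluster of `a`. -/
theorem cluster_eq_union_root (h : IsRootCut ends a₁ a₂ VR VS ER ES) {ω : Config E}
    (hR : ¬ Conn ends (restrict ER ω) a₁ a₂) (hS : ¬ Conn ends (restrict ES ω) a₁ a₂) {x a : V}
    (hx : x ∈ VS) (ha : a = a₁ ∨ a = a₂) (hxa : Conn ends (restrict ES ω) x a) :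
    cluster ends ω x = cluster ends (restrict ES ω) x ∪ cluster ends (restrict ER ω) a := by
  have hR' : ¬ Conn ends (restrict ER ω) a₂ a₁ := fun hc => hR (conn_symm hc)
  have hS' : ¬ Conn ends (restrict ES ω) a₂ a₁ := fun hc => hS (conn_symm hc)
  ext v
  constructor
  · intro hv
    rcases mem_union_of_conn h (Or.inl (Or.inr hx)) hv with (hvR | hvS) | hvroot
    · rcases (conn_across_iff h hR hS hx hvR).1 hv with ⟨h1, h2⟩ | ⟨h1, h2⟩
      · rcases ha with rfl | rfl
        · exact Or.inr h2
        · exact absurd (conn_trans (conn_symm hxa) h1) hS'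
      · rcases ha with rfl | rfl
        · exact absurd (conn_trans (conn_symm hxa) h1) hS
        · exact Or.inr h2
    · exact Or.inl ((conn_iff_restrict_of_not_conn h hR (Or.inl hx) (Or.inl hvS)).1 hv)
    · exact Or.inl ((conn_iff_restrict_of_not_conn h hR (Or.inl hx) (Or.inr hvroot)).1 hv)
  · rintro (hv | hv)
    · exact conn_mono (restrict_le ES ω) hv
    · exact conn_trans (conn_mono (restrict_le ES ω) hxa) (conn_mono (restrict_le ER ω) hv)

/-- The cluster of `x ∈ VS` when `x` reaches no root inside `S` (on `Q_R`): just the `S`-cluster. -/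
theorem cluster_eq_of_not_conn_roots (h : IsRootCut ends a₁ a₂ VR VS ER ES) {ω : Config E}
    (hR : ¬ Conn ends (restrict ER ω) a₁ a₂) (hS : ¬ Conn ends (restrict ES ω) a₁ a₂) {x : V}
    (hx : x ∈ VS) (h1 : ¬ Conn ends (restrict ES ω) x a₁) (h2 : ¬ Conn ends (restrict ES ω) x a₂) :
    cluster ends ω x = cluster ends (restrict ES ω) x := by
  ext v
  constructor
  · intro hv
    rcases mem_union_of_conn h (Or.inl (Or.inr hx)) hv with (hvR | hvS) | hvroot
    · rcases (conn_across_iff h hR hS hx hvR).1 hv with ⟨hc, _⟩ | ⟨hc, _⟩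
      · exact absurd hc h1
      · exact absurd hc h2
    · exact (conn_iff_restrict_of_not_conn h hR (Or.inl hx) (Or.inl hvS)).1 hv
    · exact (conn_iff_restrict_of_not_conn h hR (Or.inl hx) (Or.inr hvroot)).1 hv
  · exact conn_mono (restrict_le ES ω)

end Summit.Ventures.PercRepro2.RootCut
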